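import Mathlib
import Literature.NumberTheory.Transcendental.SemialgebraicMapsProofs

/-!
# `GenusTwoCycleTransfer` (crux stmt-KontsevichZagierPeriods-3408), line `separating-pencil-trace`:
# the pencil lemmas

Helper file (lands `--supports stmt-KontsevichZagierPeriods-3408`). On the genus-2 curve
`y² = f(x) = x(x−1)(x−2)(x−3)(x−5)` write `f = N·D`, `N = x(x−2)(x−5)`, `D = (x−1)(x−3)`; on each
of the ovals `J = (0,1), (2,3), (5,∞)` the map `𝚽 = √(N/D)` is a strictly increasing
`ℚ`-semialgebraic bijection onto `(0,∞)` with nowhere-vanishing derivative `𝚽′`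
(`N′D − ND′ = (x²−4x+5)² + (x−1)² + 4 > 0`), its fibre over `l > 0` is cut out by the interlacing
cubic pencil `c_l = N − l²D` (one simple root in each oval), the rule-2 weight at such a root is
`(1/√f)/|𝚽′| = 2/|∂ₓc_l|`, and the three weights cancel with signs `(+,−,+)` by partial fractions
for a monic cubic with three simple roots (the trace of `dx/y` under the separating `g¹₃`
`y/((x−1)(x−3))` of the curve). Everything here is elementary real algebra/analysis; the moves of
the Kontsevich–Zagier calculus are applied in the sibling file
`HermiteRigidityGenusTwoCycleTransfer.lean`.

References: M. Kontsevich, D. Zagier, *Periods* (2001), §1.2; J. Bochnak, M. Coste, M.-F. Roy,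
*Real Algebraic Geometry* (1998), §2.2.
-/

noncomputable section

open Set MeasureTheory MvPolynomial
open Literature.NumberTheory.Transcendental Literature.ModelTheory.ExponentialFields

namespace Summit.KontsevichZagierPeriods.HermiteRigidity.GenusTwoCycleTransfer

/-! ### The pencil

Throughout, for a real `x`: `N(x) = x(x−2)(x−5)`, `D(x) = (x−1)(x−3)`, `f(x) = x(x−1)(x−2)(x−3)(x−5) = N·D`,
`W(x) = (x²−4x+5)² + (x−1)² + 4 = N′D − ND′`, the pencil `c_l(x) = N(x) − l²D(x)` with
`∂ₓc_l(x) = 3x² − 14x + 10 − l²(2x − 4)`, the map `𝚽(x) = √(N(x)/D(x))` and its derivative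
`𝚽′(x) = (W(x)/(2N(x)D(x)))·√(N(x)/D(x))`. All of these are written out explicitly in the
statements (no definitions are introduced). -/


/-! ### Pencil algebra -/

/-- `𝐖 = (x²−4x+5)² + (x−1)² + 4 > 0`. [folklore] -/
theorem W_pos (x : ℝ) : 0 < ((x ^ 2 - 4 * x + 5) ^ 2 + (x - 1) ^ 2 + 4) := by positivity

/-- `f = N · D`. [folklore] -/
theorem f_eq (x : ℝ) : (x * (x - 1) * (x - 2) * (x - 3) * (x - 5)) = (x * (x - 2) * (x - 5)) * ((x - 1) * (x - 3)) := by ring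

/-- `𝐖 = N′D − ND′`. [folklore] -/
theorem W_eq (x : ℝ) : ((x ^ 2 - 4 * x + 5) ^ 2 + (x - 1) ^ 2 + 4) = (3 * x ^ 2 - 14 * x + 10) * ((x - 1) * (x - 3)) - (x * (x - 2) * (x - 5)) * (2 * x - 4) := by ring

/-- At a root of the pencil cubic, `D · ∂ₓc = 𝐖`. [folklore] -/
theorem dc_eq (l x : ℝ) (h : (x * (x - 2) * (x - 5) - l ^ 2 * ((x - 1) * (x - 3))) = 0) : ((x - 1) * (x - 3)) * (3 * x ^ 2 - 14 * x + 10 - l ^ 2 * (2 * x - 4)) = ((x ^ 2 - 4 * x + 5) ^ 2 + (x - 1) ^ 2 + 4) := by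
  have : x * (x - 2) * (x - 5) = l ^ 2 * ((x - 1) * (x - 3)) := by linarith
  nlinarith [this]

/-- Vieta for a monic cubic with three distinct roots: the two leading symmetric functions.
[folklore] -/
theorem cubic_vieta (a b d x₁ x₂ x₃ : ℝ) (h₁₂ : x₁ ≠ x₂) (h₁₃ : x₁ ≠ x₃) (h₂₃ : x₂ ≠ x₃)
    (h₁ : x₁ ^ 3 + a * x₁ ^ 2 + b * x₁ + d = 0) (h₂ : x₂ ^ 3 + a * x₂ ^ 2 + b * x₂ + d = 0)
    (h₃ : x₃ ^ 3 + a * x₃ ^ 2 + b * x₃ + d = 0) :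
    a = -(x₁ + x₂ + x₃) ∧ b = x₁ * x₂ + x₁ * x₃ + x₂ * x₃ := by
  have e12 : (x₂ - x₁) * ((x₂ ^ 2 + x₁ * x₂ + x₁ ^ 2) + a * (x₂ + x₁) + b) = 0 := by
    linear_combination h₂ - h₁
  have e13 : (x₃ - x₁) * ((x₃ ^ 2 + x₁ * x₃ + x₁ ^ 2) + a * (x₃ + x₁) + b) = 0 := by
    linear_combination h₃ - h₁
  have e12' : (x₂ ^ 2 + x₁ * x₂ + x₁ ^ 2) + a * (x₂ + x₁) + b = 0 :=
    (mul_eq_zero.mp e12).resolve_left (sub_ne_zero.mpr (Ne.symm h₁₂))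
  have e13' : (x₃ ^ 2 + x₁ * x₃ + x₁ ^ 2) + a * (x₃ + x₁) + b = 0 :=
    (mul_eq_zero.mp e13).resolve_left (sub_ne_zero.mpr (Ne.symm h₁₃))
  have e23 : (x₃ - x₂) * (x₃ + x₂ + x₁ + a) = 0 := by linear_combination e13' - e12'
  have ha : x₃ + x₂ + x₁ + a = 0 :=
    (mul_eq_zero.mp e23).resolve_left (sub_ne_zero.mpr (Ne.symm h₂₃))
  refine ⟨by linarith, ?_⟩
  have : a = -(x₁ + x₂ + x₃) := by linarith
  subst this
  linear_combination e12'

/-- The `x`-derivative of the pencil cubic at its three ordered roots (the cubic is monic, so it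
factors over its roots). [folklore] -/
theorem dc_at_roots (l x₁ x₂ x₃ : ℝ) (h₁₂ : x₁ < x₂) (h₂₃ : x₂ < x₃)
    (h₁ : (x₁ * (x₁ - 2) * (x₁ - 5) - l ^ 2 * ((x₁ - 1) * (x₁ - 3))) = 0) (h₂ : (x₂ * (x₂ - 2) * (x₂ - 5) - l ^ 2 * ((x₂ - 1) * (x₂ - 3))) = 0) (h₃ : (x₃ * (x₃ - 2) * (x₃ - 5) - l ^ 2 * ((x₃ - 1) * (x₃ - 3))) = 0) :
    (3 * x₁ ^ 2 - 14 * x₁ + 10 - l ^ 2 * (2 * x₁ - 4)) = (x₁ - x₂) * (x₁ - x₃) ∧ (3 * x₂ ^ 2 - 14 * x₂ + 10 - l ^ 2 * (2 * x₂ - 4)) = (x₂ - x₁) * (x₂ - x₃) ∧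
      (3 * x₃ ^ 2 - 14 * x₃ + 10 - l ^ 2 * (2 * x₃ - 4)) = (x₃ - x₁) * (x₃ - x₂) := by
  obtain ⟨ha, hb⟩ := cubic_vieta (-(7 + l ^ 2)) (10 + 4 * l ^ 2) (-3 * l ^ 2) x₁ x₂ x₃ h₁₂.ne
    (h₁₂.trans h₂₃).ne h₂₃.ne (by linear_combination h₁) (by linear_combination h₂)
    (by linear_combination h₃)
  exact ⟨by linear_combination (2 * x₁) * ha + hb, by linear_combination (2 * x₂) * ha + hb,
    by linear_combination (2 * x₃) * ha + hb⟩

/-- The trace identity behind the line: for `x₁ < x₂ < x₃`,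
`2/|(x₁−x₂)(x₁−x₃)| − 2/|(x₂−x₁)(x₂−x₃)| + 2/|(x₃−x₁)(x₃−x₂)| = 0` (partial fractions).
[folklore] -/
theorem trace_identity (x₁ x₂ x₃ : ℝ) (h₁₂ : x₁ < x₂) (h₂₃ : x₂ < x₃) :
    2 / |(x₂ - x₁) * (x₂ - x₃)| = 2 / |(x₁ - x₂) * (x₁ - x₃)| + 2 / |(x₃ - x₁) * (x₃ - x₂)| := by
  have h₁₃ := h₁₂.trans h₂₃
  rw [abs_of_neg (mul_neg_of_pos_of_neg (sub_pos.mpr h₁₂) (sub_neg.mpr h₂₃)),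
    abs_of_pos (mul_pos_of_neg_of_neg (sub_neg.mpr h₁₂) (sub_neg.mpr h₁₃)),
    abs_of_pos (mul_pos (sub_pos.mpr h₁₃) (sub_pos.mpr h₂₃))]
  have : x₁ - x₂ ≠ 0 := sub_ne_zero.mpr h₁₂.ne
  have : x₁ - x₃ ≠ 0 := sub_ne_zero.mpr h₁₃.ne
  have : x₂ - x₃ ≠ 0 := sub_ne_zero.mpr h₂₃.ne
  have : x₂ - x₁ ≠ 0 := sub_ne_zero.mpr h₁₂.ne'
  have : x₃ - x₁ ≠ 0 := sub_ne_zero.mpr h₁₃.ne'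
  have : x₃ - x₂ ≠ 0 := sub_ne_zero.mpr h₂₃.ne'
  field_simp
  ring

/-- At a root `x` of `c_l` (`l > 0`, `D(x) ≠ 0`): `𝚽(x) = l`. [folklore] -/
theorem phi_root (l x : ℝ) (hl : 0 < l) (hD : ((x - 1) * (x - 3)) ≠ 0) (hc : (x * (x - 2) * (x - 5) - l ^ 2 * ((x - 1) * (x - 3))) = 0) : Real.sqrt (x * (x - 2) * (x - 5) / ((x - 1) * (x - 3))) = l := by
  have hN : (x * (x - 2) * (x - 5)) = l ^ 2 * ((x - 1) * (x - 3)) := by linarith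
  rw [hN, mul_div_assoc, div_self hD, mul_one, Real.sqrt_sq hl.le]

/-- The rule-2 weight at a root `x` of `c_l`: `(1/√f(x)) / |𝚽′(x)| = 2/|∂ₓc_l(x)|`. [folklore] -/
theorem weight_root (l x : ℝ) (hl : 0 < l) (hD : ((x - 1) * (x - 3)) ≠ 0) (hc : (x * (x - 2) * (x - 5) - l ^ 2 * ((x - 1) * (x - 3))) = 0)
    (hdc : (3 * x ^ 2 - 14 * x + 10 - l ^ 2 * (2 * x - 4)) ≠ 0) : 1 / Real.sqrt (x * (x - 1) * (x - 2) * (x - 3) * (x - 5)) / |(((x ^ 2 - 4 * x + 5) ^ 2 + (x - 1) ^ 2 + 4) / (2 * (x * (x - 2) * (x - 5)) * ((x - 1) * (x - 3))) * Real.sqrt (x * (x - 2) * (x - 5) / ((x - 1) * (x - 3))))| = 2 / |(3 * x ^ 2 - 14 * x + 10 - l ^ 2 * (2 * x - 4))| := by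
  have hsρ : Real.sqrt ((x * (x - 2) * (x - 5)) / ((x - 1) * (x - 3))) = l := phi_root l x hl hD hc
  have hW : ((x ^ 2 - 4 * x + 5) ^ 2 + (x - 1) ^ 2 + 4) = ((x - 1) * (x - 3)) * (3 * x ^ 2 - 14 * x + 10 - l ^ 2 * (2 * x - 4)) := (dc_eq l x hc).symm
  have hN : (x * (x - 2) * (x - 5)) = l ^ 2 * ((x - 1) * (x - 3)) := by linarith
  rw [f_eq, hsρ, hW, hN]
  set d : ℝ := ((x - 1) * (x - 3)) with hd
  set e : ℝ := (3 * x ^ 2 - 14 * x + 10 - l ^ 2 * (2 * x - 4)) with he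
  clear_value d e
  have hl0 : l ≠ 0 := hl.ne'
  have h1 : Real.sqrt (l ^ 2 * d * d) = l * |d| := by
    rw [show l ^ 2 * d * d = (l * d) ^ 2 by ring, Real.sqrt_sq_eq_abs, abs_mul, abs_of_pos hl]
  have h2 : d * e / (2 * (l ^ 2 * d) * d) * l = e / (2 * l * d) := by
    field_simp
  have h3 : |e / (2 * l * d)| = |e| / (2 * l * |d|) := by
    rw [abs_div, abs_mul, abs_of_pos (by positivity : (0:ℝ) < 2 * l)]
  rw [h1, h2, h3]
  have hda : |d| ≠ 0 := abs_ne_zero.mpr hD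
  have hea : |e| ≠ 0 := abs_ne_zero.mpr hdc
  rw [div_div_eq_mul_div]
  congr 1
  field_simp

/-! ### Pencil analysis: signs, derivative, injectivity, interlacing -/

/-- Signs on `(0,1)`: `N > 0`, `D > 0`. [folklore] -/
theorem signs_Ioo01 (x : ℝ) (hx : x ∈ Ioo (0:ℝ) 1) : 0 < (x * (x - 2) * (x - 5)) ∧ 0 < ((x - 1) * (x - 3)) :=
  ⟨mul_pos_of_neg_of_neg (mul_neg_of_pos_of_neg hx.1 (by linarith [hx.2])) (by linarith [hx.2]),
    mul_pos_of_neg_of_neg (by linarith [hx.2]) (by linarith [hx.2])⟩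

/-- Signs on `(2,3)`: `N < 0`, `D < 0`. [folklore] -/
theorem signs_Ioo23 (x : ℝ) (hx : x ∈ Ioo (2:ℝ) 3) : (x * (x - 2) * (x - 5)) < 0 ∧ ((x - 1) * (x - 3)) < 0 :=
  ⟨mul_neg_of_pos_of_neg (mul_pos (by linarith [hx.1]) (by linarith [hx.1])) (by linarith [hx.2]),
    mul_neg_of_pos_of_neg (by linarith [hx.1]) (by linarith [hx.2])⟩

/-- Signs on `(5,∞)`: `N > 0`, `D > 0`. [folklore] -/
theorem signs_Ioi5 (x : ℝ) (hx : x ∈ Ioi (5:ℝ)) : 0 < (x * (x - 2) * (x - 5)) ∧ 0 < ((x - 1) * (x - 3)) := by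
  have hx' : 5 < x := hx
  exact ⟨mul_pos (mul_pos (by linarith) (by linarith)) (by linarith),
    mul_pos (by linarith) (by linarith)⟩

/-- Derivative of `ρ = N/D` where `D ≠ 0`: `ρ′ = 𝐖/D²`. [folklore] -/
theorem hasDerivAt_rho (x : ℝ) (hD : ((x - 1) * (x - 3)) ≠ 0) :
    HasDerivAt (fun y : ℝ => (y * (y - 2) * (y - 5)) / ((y - 1) * (y - 3))) (((x ^ 2 - 4 * x + 5) ^ 2 + (x - 1) ^ 2 + 4) / ((x - 1) * (x - 3)) ^ 2) x := by
  have hN : HasDerivAt (fun y : ℝ => (y * (y - 2) * (y - 5))) ((1 * (x - 2) + x * 1) * (x - 5) + x * (x - 2) * 1) x :=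
    ((hasDerivAt_id x).mul ((hasDerivAt_id x).sub_const 2)).mul ((hasDerivAt_id x).sub_const 5)
  have hD' : HasDerivAt (fun y : ℝ => ((y - 1) * (y - 3))) (1 * (x - 3) + (x - 1) * 1) x :=
    ((hasDerivAt_id x).sub_const 1).mul ((hasDerivAt_id x).sub_const 3)
  refine (hN.div hD' hD).congr_deriv ?_
  rw [W_eq]
  ring

/-- Derivative of `𝚽 = √(N/D)` where `N, D ≠ 0`, `N/D > 0`: `𝚽′`. [folklore] -/
theorem hasDerivAt_phi (x : ℝ) (hN : (x * (x - 2) * (x - 5)) ≠ 0) (hD : ((x - 1) * (x - 3)) ≠ 0) (hρ : 0 < (x * (x - 2) * (x - 5)) / ((x - 1) * (x - 3))) :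
    HasDerivAt (fun y : ℝ => Real.sqrt (y * (y - 2) * (y - 5) / ((y - 1) * (y - 3)))) ((((x ^ 2 - 4 * x + 5) ^ 2 + (x - 1) ^ 2 + 4) / (2 * (x * (x - 2) * (x - 5)) * ((x - 1) * (x - 3))) * Real.sqrt (x * (x - 2) * (x - 5) / ((x - 1) * (x - 3))))) x := by
  refine ((hasDerivAt_rho x hD).sqrt hρ.ne').congr_deriv ?_
  set n := (x * (x - 2) * (x - 5)) with hn
  set d := ((x - 1) * (x - 3)) with hd
  set w := ((x ^ 2 - 4 * x + 5) ^ 2 + (x - 1) ^ 2 + 4) with hw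
  have hs : Real.sqrt (n / d) * Real.sqrt (n / d) = n / d := Real.mul_self_sqrt hρ.le
  have hs0 : Real.sqrt (n / d) ≠ 0 := (Real.sqrt_pos.mpr hρ).ne'
  rw [div_eq_iff (mul_ne_zero two_ne_zero hs0)]
  calc w / d ^ 2 = w / (2 * n * d) * 2 * (n / d) := by field_simp
    _ = w / (2 * n * d) * 2 * (Real.sqrt (n / d) * Real.sqrt (n / d)) := by rw [hs]
    _ = w / (2 * n * d) * Real.sqrt (n / d) * (2 * Real.sqrt (n / d)) := by ring

/-- `𝚽′ ≠ 0` where `N, D ≠ 0`, `N/D > 0`. [folklore] -/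
theorem phi'_ne_zero (x : ℝ) (hN : (x * (x - 2) * (x - 5)) ≠ 0) (hD : ((x - 1) * (x - 3)) ≠ 0) (hρ : 0 < (x * (x - 2) * (x - 5)) / ((x - 1) * (x - 3))) :
    (((x ^ 2 - 4 * x + 5) ^ 2 + (x - 1) ^ 2 + 4) / (2 * (x * (x - 2) * (x - 5)) * ((x - 1) * (x - 3))) * Real.sqrt (x * (x - 2) * (x - 5) / ((x - 1) * (x - 3)))) ≠ 0 :=
  mul_ne_zero (div_ne_zero (W_pos x).ne' (mul_ne_zero (mul_ne_zero two_ne_zero hN) hD))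
    (Real.sqrt_pos.mpr hρ).ne'

/-- `𝚽` is injective on every open interval where `D ≠ 0` and `N/D > 0` (there `ρ′ = 𝐖/D² > 0`,
so `ρ`, hence `√ρ`, is strictly increasing). [folklore] -/
theorem phi_injOn {J : Set ℝ} (hJ : Convex ℝ J) (hJo : IsOpen J) (hD : ∀ x ∈ J, ((x - 1) * (x - 3)) ≠ 0)
    (hρ : ∀ x ∈ J, 0 < (x * (x - 2) * (x - 5)) / ((x - 1) * (x - 3))) : InjOn (fun x : ℝ => Real.sqrt (x * (x - 2) * (x - 5) / ((x - 1) * (x - 3)))) J := by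
  have hcont : ContinuousOn (fun y : ℝ => (y * (y - 2) * (y - 5)) / ((y - 1) * (y - 3))) J :=
    fun x hx => ((hasDerivAt_rho x (hD x hx)).continuousAt).continuousWithinAt
  have hmono : StrictMonoOn (fun y : ℝ => (y * (y - 2) * (y - 5)) / ((y - 1) * (y - 3))) J := by
    refine strictMonoOn_of_deriv_pos hJ hcont fun x hx => ?_
    rw [hJo.interior_eq] at hx
    rw [(hasDerivAt_rho x (hD x hx)).deriv]
    exact div_pos (W_pos x) (pow_pos (abs_pos.mpr (hD x hx)) 2 |>.trans_eq (by rw [sq_abs]))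
  intro x hx y hy hxy
  by_contra hne
  rcases lt_or_gt_of_ne hne with h | h
  · exact absurd hxy (Real.sqrt_lt_sqrt (hρ x hx).le (hmono hx hy h)).ne
  · exact absurd hxy (Real.sqrt_lt_sqrt (hρ y hy).le (hmono hy hx h)).ne'

/-- Interlacing on `(0,1)`: `c_l(0) = −3l² < 0 < 4 = c_l(1)`. [folklore] -/
theorem exists_root_Ioo01 (l : ℝ) (hl : 0 < l) : ∃ x ∈ Ioo (0:ℝ) 1, (x * (x - 2) * (x - 5) - l ^ 2 * ((x - 1) * (x - 3))) = 0 := by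
  have hc : ContinuousOn (fun x : ℝ => (x * (x - 2) * (x - 5) - l ^ 2 * ((x - 1) * (x - 3)))) (Icc 0 1) := by fun_prop
  have h0 : (0:ℝ) ∈ Ioo (((0:ℝ)) * (((0:ℝ)) - 2) * (((0:ℝ)) - 5) - l ^ 2 * ((((0:ℝ)) - 1) * (((0:ℝ)) - 3))) (((1:ℝ)) * (((1:ℝ)) - 2) * (((1:ℝ)) - 5) - l ^ 2 * ((((1:ℝ)) - 1) * (((1:ℝ)) - 3))) := by
    constructor <;> nlinarith [sq_pos_of_pos hl]
  exact intermediate_value_Ioo (show (0:ℝ) ≤ 1 by norm_num) hc h0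

/-- Interlacing on `(2,3)`: `c_l(2) = l² > 0 > −6 = c_l(3)`. [folklore] -/
theorem exists_root_Ioo23 (l : ℝ) (hl : 0 < l) : ∃ x ∈ Ioo (2:ℝ) 3, (x * (x - 2) * (x - 5) - l ^ 2 * ((x - 1) * (x - 3))) = 0 := by
  have hc : ContinuousOn (fun x : ℝ => (x * (x - 2) * (x - 5) - l ^ 2 * ((x - 1) * (x - 3)))) (Icc 2 3) := by fun_prop
  have h0 : (0:ℝ) ∈ Ioo (((3:ℝ)) * (((3:ℝ)) - 2) * (((3:ℝ)) - 5) - l ^ 2 * ((((3:ℝ)) - 1) * (((3:ℝ)) - 3))) (((2:ℝ)) * (((2:ℝ)) - 2) * (((2:ℝ)) - 5) - l ^ 2 * ((((2:ℝ)) - 1) * (((2:ℝ)) - 3))) := by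
    constructor <;> nlinarith [sq_pos_of_pos hl]
  exact intermediate_value_Ioo' (show (2:ℝ) ≤ 3 by norm_num) hc h0

/-- Interlacing on `(5,∞)`: `c_l(5) = −8l² < 0 < 70 + 35l² + 4l⁴ = c_l(7 + l²)`. [folklore] -/
theorem exists_root_Ioi5 (l : ℝ) (hl : 0 < l) : ∃ x ∈ Ioi (5:ℝ), (x * (x - 2) * (x - 5) - l ^ 2 * ((x - 1) * (x - 3))) = 0 := by
  have hc : ContinuousOn (fun x : ℝ => (x * (x - 2) * (x - 5) - l ^ 2 * ((x - 1) * (x - 3)))) (Icc 5 (7 + l ^ 2)) := by fun_prop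
  have h7 : (((7 + l ^ 2 : ℝ)) * (((7 + l ^ 2 : ℝ)) - 2) * (((7 + l ^ 2 : ℝ)) - 5) - l ^ 2 * ((((7 + l ^ 2 : ℝ)) - 1) * (((7 + l ^ 2 : ℝ)) - 3))) = 70 + 35 * l ^ 2 + 4 * l ^ 4 := by ring
  have h0 : (0:ℝ) ∈ Ioo (((5:ℝ)) * (((5:ℝ)) - 2) * (((5:ℝ)) - 5) - l ^ 2 * ((((5:ℝ)) - 1) * (((5:ℝ)) - 3))) (((7 + l ^ 2 : ℝ)) * (((7 + l ^ 2 : ℝ)) - 2) * (((7 + l ^ 2 : ℝ)) - 5) - l ^ 2 * ((((7 + l ^ 2 : ℝ)) - 1) * (((7 + l ^ 2 : ℝ)) - 3))) := by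
    refine ⟨by nlinarith [sq_pos_of_pos hl], ?_⟩
    rw [h7]
    positivity
  obtain ⟨x, hx, hx0⟩ := intermediate_value_Ioo (show (5:ℝ) ≤ 7 + l ^ 2 by nlinarith) hc h0
  exact ⟨x, hx.1, hx0⟩

/-! ### Semialgebraicity of `𝚽`, `𝚽′` -/

/-- `p ↦ 𝚽(p 0)` is `ℚ`-semialgebraic on any `ℚ`-semialgebraic `σ ⊆ ℝ¹` where `D ≠ 0`.
[cite: BochnakCosteRoy1998, §2.2] -/
theorem phi_semialgebraic {σ : Set (Fin 1 → ℝ)} (hσ : IsSemialgebraic ℚ σ)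
    (hD : ∀ p ∈ σ, (((p 0) - 1) * ((p 0) - 3)) ≠ 0) : IsSemialgebraicFunOn ℚ σ (fun p => Real.sqrt ((p 0) * ((p 0) - 2) * ((p 0) - 5) / (((p 0) - 1) * ((p 0) - 3)))) := by
  have h1 := isSemialgebraicFunOn_aeval_div_aeval hσ
    (X 0 * (X 0 - 2) * (X 0 - 5) : MvPolynomial (Fin 1) ℚ) ((X 0 - 1) * (X 0 - 3))
    (fun p hp => by simpa using hD p hp)
  have h2 : IsSemialgebraicFunOn ℚ σ (fun p => ((p 0) * ((p 0) - 2) * ((p 0) - 5)) / (((p 0) - 1) * ((p 0) - 3))) :=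
    h1.congr (fun p _ => by simp)
  exact IsSemialgebraicFunOn.sqrt_holds h2

/-- `p ↦ 𝚽′(p 0)` is `ℚ`-semialgebraic on any `ℚ`-semialgebraic `σ ⊆ ℝ¹` where `N, D ≠ 0`.
[cite: BochnakCosteRoy1998, Prop. 2.2.6] -/
theorem phi'_semialgebraic {σ : Set (Fin 1 → ℝ)} (hσ : IsSemialgebraic ℚ σ)
    (hN : ∀ p ∈ σ, ((p 0) * ((p 0) - 2) * ((p 0) - 5)) ≠ 0) (hD : ∀ p ∈ σ, (((p 0) - 1) * ((p 0) - 3)) ≠ 0) :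
    IsSemialgebraicFunOn ℚ σ (fun p => ((((p 0) ^ 2 - 4 * (p 0) + 5) ^ 2 + ((p 0) - 1) ^ 2 + 4) / (2 * ((p 0) * ((p 0) - 2) * ((p 0) - 5)) * (((p 0) - 1) * ((p 0) - 3))) * Real.sqrt ((p 0) * ((p 0) - 2) * ((p 0) - 5) / (((p 0) - 1) * ((p 0) - 3))))) := by
  have h1 := isSemialgebraicFunOn_aeval_div_aeval hσ
    ((X 0 ^ 2 - 4 * X 0 + 5) ^ 2 + (X 0 - 1) ^ 2 + 4 : MvPolynomial (Fin 1) ℚ)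
    (2 * (X 0 * (X 0 - 2) * (X 0 - 5)) * ((X 0 - 1) * (X 0 - 3)))
    (fun p hp => by
      simp only [map_mul, map_sub, aeval_X, map_ofNat, map_one]
      exact mul_ne_zero (mul_ne_zero two_ne_zero (hN p hp)) (hD p hp))
  have h2 : IsSemialgebraicFunOn ℚ σ
      (fun p => (((p 0) ^ 2 - 4 * (p 0) + 5) ^ 2 + ((p 0) - 1) ^ 2 + 4) / (2 * ((p 0) * ((p 0) - 2) * ((p 0) - 5)) * (((p 0) - 1) * ((p 0) - 3)))) :=
    h1.congr (fun p _ => by simp)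
  exact IsSemialgebraicFunOn.mul_holds h2 (phi_semialgebraic hσ hD)

/-! ### The image of an oval under `𝚽` -/

/-- The image of `{p | p 0 ∈ J}` under `p ↦ (𝚽(p 0))` is the half-line `{q | 0 < q 0}` as soon as
`𝚽 > 0` on `J` and every level `l > 0` is attained on `J`. [folklore] -/
theorem image_phi_eq {J : Set ℝ} {σ : Set (Fin 1 → ℝ)} (hd : σ = {p | p 0 ∈ J})
    (hpos : ∀ x ∈ J, 0 < Real.sqrt (x * (x - 2) * (x - 5) / ((x - 1) * (x - 3)))) (hsurj : ∀ l, 0 < l → ∃ x ∈ J, Real.sqrt (x * (x - 2) * (x - 5) / ((x - 1) * (x - 3))) = l) :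
    (fun p : Fin 1 → ℝ => fun _ : Fin 1 => Real.sqrt ((p 0) * ((p 0) - 2) * ((p 0) - 5) / (((p 0) - 1) * ((p 0) - 3)))) '' σ = {q | 0 < q 0} := by
  ext q
  constructor
  · rintro ⟨p, hp, rfl⟩
    rw [hd] at hp
    exact hpos _ hp
  · intro hq
    obtain ⟨x, hx, hxl⟩ := hsurj (q 0) hq
    refine ⟨fun _ => x, by rw [hd]; exact hx, ?_⟩
    funext i
    rw [Fin.fin_one_eq_zero i]
    exact hxl

end Summit.KontsevichZagierPeriods.HermiteRigidity.GenusTwoCycleTransfer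

end
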